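import Mathlib
import Literature.Analysis.FluidPDE.VectorCalculus
import Literature.Analysis.FluidPDE.VorticityCalculus
import Literature.Analysis.FluidPDE.ElgindiBlowup

/-!
# Local momentum against a solenoidal test is bounded by the enstrophy

Helper file of the stub `landauTail_vorticity_moment_bound` (W4) of the crux
`LandauTail.LandauTailBlowup` (stmt-NavierStokesRegularity-1944, line registered): for
`Ψ ∈ C²_c(ℝ³; ℝ³)` and `v ∈ C¹(ℝ³; ℝ³)`,

  `|∫ ⟪v, curl Ψ⟫| ≤ 4 ∫ ‖Ψ‖ ‖Dv‖`.

Proof: integration by parts for the curl, `∫ ⟪curl v, Ψ⟫ = ∫ ⟪v, curl Ψ⟫`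
(`Literature.Analysis.FluidPDE.integral_inner_curl_eq_integral_inner_curl`, i.e. the tree's
`div (Ψ × v) = ⟪v, curl Ψ⟫ − ⟪Ψ, curl v⟫` integrated over `ℝ³` with Gauss–Green without
boundary), then Cauchy–Schwarz pointwise and the crude bound `‖curl v x‖ ≤ 4 ‖Dv(x)‖`
(`Literature.Analysis.FluidPDE.norm_curl_le_four_mul`; Majda–Bertozzi, §1.1–1.2).
-/

set_option linter.dupNamespace false

namespace Summit.NavierStokesRegularity.NavierStokesRegularity.Theorems

open MeasureTheory Literature.Analysis.FluidPDE
open scoped InnerProductSpace RealInnerProductSpace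

/-- **Local momentum against a solenoidal test is bounded by the enstrophy density**: for
`Ψ ∈ C²_c(ℝ³; ℝ³)` and `v ∈ C¹(ℝ³; ℝ³)`, `|∫ ⟪v, curl Ψ⟫| ≤ 4 ∫ ‖Ψ‖ ‖Dv‖` (integrate by parts,
`∫ ⟪v, curl Ψ⟫ = ∫ ⟪curl v, Ψ⟫`, then `|⟪curl v, Ψ⟫| ≤ ‖curl v‖ ‖Ψ‖ ≤ 4 ‖Dv‖ ‖Ψ‖`;
Majda–Bertozzi, *Vorticity and Incompressible Flow*, §1.1–1.2). [folklore] -/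
theorem landauTail_vorticity_moment_bound : ∀ (Ψ v : EuclideanSpace ℝ (Fin 3) → EuclideanSpace ℝ (Fin 3)), ContDiff ℝ 2 Ψ → HasCompactSupport Ψ → ContDiff ℝ 1 v → |∫ x, inner ℝ (v x) (Literature.Analysis.FluidPDE.curl Ψ x)| ≤ 4 * ∫ x, ‖Ψ x‖ * ‖fderiv ℝ v x‖ := by
  intro Ψ v hΨ hc hv
  have hΨ1 : ContDiff ℝ 1 Ψ := hΨ.of_le (by norm_num)
  rw [← integral_inner_curl_eq_integral_inner_curl hv hΨ1 hc]
  -- the dominating integrand `4 ‖Ψ‖ ‖Dv‖` is continuous with compact support, hence integrable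
  have hgi : Integrable (fun x => 4 * (‖Ψ x‖ * ‖fderiv ℝ v x‖))
      (volume : Measure (EuclideanSpace ℝ (Fin 3))) := by
    refine (continuous_const.mul (hΨ.continuous.norm.mul
      (hv.continuous_fderiv one_ne_zero).norm)).integrable_of_hasCompactSupport ?_
    refine (hc.norm.mul_right).mul_left
  calc |∫ x, ⟪curl v x, Ψ x⟫|
      = ‖∫ x, ⟪curl v x, Ψ x⟫‖ := (Real.norm_eq_abs _).symm
    _ ≤ ∫ x, ‖⟪curl v x, Ψ x⟫‖ := norm_integral_le_integral_norm _
    _ ≤ ∫ x, 4 * (‖Ψ x‖ * ‖fderiv ℝ v x‖) := by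
        refine integral_mono_of_nonneg (Filter.Eventually.of_forall fun x => norm_nonneg _) hgi
          (Filter.Eventually.of_forall fun x => ?_)
        calc ‖⟪curl v x, Ψ x⟫‖ ≤ ‖curl v x‖ * ‖Ψ x‖ := norm_inner_le_norm _ _
          _ ≤ 4 * ‖fderiv ℝ v x‖ * ‖Ψ x‖ := by
              gcongr
              exact norm_curl_le_four_mul v x
          _ = 4 * (‖Ψ x‖ * ‖fderiv ℝ v x‖) := by ring
    _ = 4 * ∫ x, ‖Ψ x‖ * ‖fderiv ℝ v x‖ := integral_const_mul _ _

end Summit.NavierStokesRegularity.NavierStokesRegularity.Theorems
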